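import Summits.Ventures.CertifiedArithmetic.LowPrec.PatternEnvelopeAddModes
import Literature.ComputerArithmetic.FloatingPoint.Formats

/-!
# Pattern route of Theorem E5, part 5: the FP6/FP4 sum constants recomputed WITHOUT
# operand-pair enumeration

HONEST FRAMING (venture CertifiedArithmetic / cell `pub-lowprec`): certified error envelopes and
provably optimal rounding/accumulation schemes for low-precision formats under stated cost models;
every table by two implementations; no hardware or vendor claims.

"Every table by two implementations", inside Lean, for SUMS: the kernel-exhaustive sum tables
of `EnvelopesE2M1/E3M2/E2M3.lean`, `EnvelopesMixed*.lean` (nearest) and `EnvelopesDirected*.lean`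
(RZ / RD / RU) decide a predicate over ALL operand pairs; here the same normal-range constants
come out of the PATTERN ROUTE of `PatternEnvelopeAdd.lean` — maxima of the closed-form
significand-pattern error over the realisable-and-placeable aligned-sum patterns (THEOREMS-R1
Theorem E5; third route `code/enum/envconst.py`, pre-registered
`certs/enum/PREDICTIONS-ENVCONST-FP6FP4*.json`) — by `decide` on pattern-level lists only,
one theorem per (key, rounding column). For each of the nine FP6/FP4 sum keys `X + Y → X`:
`X_Y_add_X_patternConstantNE/TZ/Dir` (nearest, toward zero, round down = round up; the TZ/Dir
values coincide with the literals of the kernel-exhaustive `X_Y_add_X_relRZ/RD/RU_normal`, which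
are not restated) and `X_Y_add_X_relNE_pattern` (the NEAREST table theorem in the sharp shape:
bound over all operand pairs on the normal range AND a maximiser, from
`MiniFloat.add_relNE_normal_of_envconst`; new in this shape).
Constants (nearest, toward zero, directed): `E2M1+E2M1 → E2M1: 1/5, 3/11, 1/3`;
`E2M1+E2M3 → E2M1: 1/5, 15/47, 5/11`; `E2M1+E3M2 → E2M1: 1/5, 31/95, 31/65`;
`E2M3+E2M1 → E2M3: 1/17, 3/35, 1/11`; `E2M3+E2M3 → E2M3: 1/17, 3/35, 1/11`;
`E2M3+E3M2 → E2M3: 1/17, 7/71, 7/65`; `E3M2+E2M1 → E3M2: 1/9, 7/39, 3/13`;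
`E3M2+E2M3 → E3M2: 1/9, 31/159, 31/129`; `E3M2+E3M2 → E3M2: 1/9, 63/319, 63/257` — identical to
`envelope_constants_E5` of `certs/enum/THEOREMS-R1-FP6FP4MIXED.json` / ENVELOPES.md.
The wide-destination cells (incl. the ENVELOPES.md Table 2 erratum cell
`E3M2 + E3M2 → BFloat16 = 1/257`) are in `PatternEnvelopeAddWide.lean`. FP8 keys are deliberately
not instantiated (cell rule: FP8 tables are held).

Placement: venture development under `Summits/Ventures/CertifiedArithmetic/` (operator decision,
BOARD.md); new work of the venture, elementary ([folklore]; format parameters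
[cite: OCP-MX-v1.0, §5.3]).
-/

namespace Summit.Ventures.CertifiedArithmetic

open Literature.ComputerArithmetic.FloatingPoint
open Literature.ComputerArithmetic.FloatingPoint.Format
open Literature.ComputerArithmetic.FloatingPoint.MiniFloat

/-- `E2M1 + E2M1 → E2M1`, NEAREST pattern constant `1/5` (THEOREMS-R1 Theorem E5; no operand-pair
enumeration). [folklore] -/
theorem E2M1_E2M1_add_E2M1_patternConstantNE : envconstAddNE E2M1 E2M1 E2M1 = 1 / 5 := by
  decide +kernel

/-- `E2M1 + E2M1 → E2M1`, TOWARD-ZERO pattern constant `3/11`. [folklore] -/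
theorem E2M1_E2M1_add_E2M1_patternConstantTZ : envconstAddTZ E2M1 E2M1 E2M1 = 3 / 11 := by
  decide +kernel

/-- `E2M1 + E2M1 → E2M1`, DIRECTED (round down = round up) pattern constant `1/3`. [folklore] -/
theorem E2M1_E2M1_add_E2M1_patternConstantDir : envconstAddDir E2M1 E2M1 E2M1 = 1 / 3 := by
  decide +kernel

/-- `E2M1 + E2M1 → E2M1`, NEAREST, by the PATTERN ROUTE: on the normal range `1 ≤ |t| ≤ 6`
of `E2M1` every sum of data satisfies `|RNE(t) - t| ≤ 1/5 · |t|`, and the constant is attained.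
[folklore] -/
theorem E2M1_E2M1_add_E2M1_relNE_pattern :
    (∀ (a : MiniFloat E2M1) (b : MiniFloat E2M1),
        (1 : ℚ) ≤ |a.toRat + b.toRat| → |a.toRat + b.toRat| ≤ E2M1.maxRat →
          |(roundNE E2M1 (a.toRat + b.toRat)).toRat - (a.toRat + b.toRat)|
            ≤ 1 / 5 * |a.toRat + b.toRat|) ∧
      ∃ (a : MiniFloat E2M1) (b : MiniFloat E2M1),
        (1 : ℚ) ≤ |a.toRat + b.toRat| ∧ |a.toRat + b.toRat| ≤ E2M1.maxRat ∧
          |(roundNE E2M1 (a.toRat + b.toRat)).toRat - (a.toRat + b.toRat)|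
            = 1 / 5 * |a.toRat + b.toRat| :=
  add_relNE_normal_of_envconst E2M1 (by decide +kernel) E2M1_E2M1_add_E2M1_patternConstantNE
    (by decide +kernel)

/-- `E2M1 + E2M3 → E2M1`, NEAREST pattern constant `1/5` (THEOREMS-R1 Theorem E5; no operand-pair
enumeration). [folklore] -/
theorem E2M1_E2M3_add_E2M1_patternConstantNE : envconstAddNE E2M1 E2M3 E2M1 = 1 / 5 := by
  decide +kernel

/-- `E2M1 + E2M3 → E2M1`, TOWARD-ZERO pattern constant `15/47`. [folklore] -/
theorem E2M1_E2M3_add_E2M1_patternConstantTZ : envconstAddTZ E2M1 E2M3 E2M1 = 15 / 47 := by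
  decide +kernel

/-- `E2M1 + E2M3 → E2M1`, DIRECTED (round down = round up) pattern constant `5/11`. [folklore] -/
theorem E2M1_E2M3_add_E2M1_patternConstantDir : envconstAddDir E2M1 E2M3 E2M1 = 5 / 11 := by
  decide +kernel

/-- `E2M1 + E2M3 → E2M1`, NEAREST, by the PATTERN ROUTE: on the normal range `1 ≤ |t| ≤ 6`
of `E2M1` every sum of data satisfies `|RNE(t) - t| ≤ 1/5 · |t|`, and the constant is attained.
[folklore] -/
theorem E2M1_E2M3_add_E2M1_relNE_pattern :
    (∀ (a : MiniFloat E2M1) (b : MiniFloat E2M3),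
        (1 : ℚ) ≤ |a.toRat + b.toRat| → |a.toRat + b.toRat| ≤ E2M1.maxRat →
          |(roundNE E2M1 (a.toRat + b.toRat)).toRat - (a.toRat + b.toRat)|
            ≤ 1 / 5 * |a.toRat + b.toRat|) ∧
      ∃ (a : MiniFloat E2M1) (b : MiniFloat E2M3),
        (1 : ℚ) ≤ |a.toRat + b.toRat| ∧ |a.toRat + b.toRat| ≤ E2M1.maxRat ∧
          |(roundNE E2M1 (a.toRat + b.toRat)).toRat - (a.toRat + b.toRat)|
            = 1 / 5 * |a.toRat + b.toRat| :=
  add_relNE_normal_of_envconst E2M1 (by decide +kernel) E2M1_E2M3_add_E2M1_patternConstantNE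
    (by decide +kernel)

/-- `E2M1 + E3M2 → E2M1`, NEAREST pattern constant `1/5` (THEOREMS-R1 Theorem E5; no operand-pair
enumeration). [folklore] -/
theorem E2M1_E3M2_add_E2M1_patternConstantNE : envconstAddNE E2M1 E3M2 E2M1 = 1 / 5 := by
  decide +kernel

/-- `E2M1 + E3M2 → E2M1`, TOWARD-ZERO pattern constant `31/95`. [folklore] -/
theorem E2M1_E3M2_add_E2M1_patternConstantTZ : envconstAddTZ E2M1 E3M2 E2M1 = 31 / 95 := by
  decide +kernel

/-- `E2M1 + E3M2 → E2M1`, DIRECTED (round down = round up) pattern constant `31/65`. [folklore] -/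
theorem E2M1_E3M2_add_E2M1_patternConstantDir : envconstAddDir E2M1 E3M2 E2M1 = 31 / 65 := by
  decide +kernel

/-- `E2M1 + E3M2 → E2M1`, NEAREST, by the PATTERN ROUTE: on the normal range `1 ≤ |t| ≤ 6`
of `E2M1` every sum of data satisfies `|RNE(t) - t| ≤ 1/5 · |t|`, and the constant is attained.
[folklore] -/
theorem E2M1_E3M2_add_E2M1_relNE_pattern :
    (∀ (a : MiniFloat E2M1) (b : MiniFloat E3M2),
        (1 : ℚ) ≤ |a.toRat + b.toRat| → |a.toRat + b.toRat| ≤ E2M1.maxRat →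
          |(roundNE E2M1 (a.toRat + b.toRat)).toRat - (a.toRat + b.toRat)|
            ≤ 1 / 5 * |a.toRat + b.toRat|) ∧
      ∃ (a : MiniFloat E2M1) (b : MiniFloat E3M2),
        (1 : ℚ) ≤ |a.toRat + b.toRat| ∧ |a.toRat + b.toRat| ≤ E2M1.maxRat ∧
          |(roundNE E2M1 (a.toRat + b.toRat)).toRat - (a.toRat + b.toRat)|
            = 1 / 5 * |a.toRat + b.toRat| :=
  add_relNE_normal_of_envconst E2M1 (by decide +kernel) E2M1_E3M2_add_E2M1_patternConstantNE
    (by decide +kernel)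

/-- `E2M3 + E2M1 → E2M3`, NEAREST pattern constant `1/17` (THEOREMS-R1 Theorem E5; no operand-pair
enumeration). [folklore] -/
theorem E2M3_E2M1_add_E2M3_patternConstantNE : envconstAddNE E2M3 E2M1 E2M3 = 1 / 17 := by
  decide +kernel

/-- `E2M3 + E2M1 → E2M3`, TOWARD-ZERO pattern constant `3/35`. [folklore] -/
theorem E2M3_E2M1_add_E2M3_patternConstantTZ : envconstAddTZ E2M3 E2M1 E2M3 = 3 / 35 := by
  decide +kernel

/-- `E2M3 + E2M1 → E2M3`, DIRECTED (round down = round up) pattern constant `1/11`. [folklore] -/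
theorem E2M3_E2M1_add_E2M3_patternConstantDir : envconstAddDir E2M3 E2M1 E2M3 = 1 / 11 := by
  decide +kernel

/-- `E2M3 + E2M1 → E2M3`, NEAREST, by the PATTERN ROUTE: on the normal range `1 ≤ |t| ≤ 15/2`
of `E2M3` every sum of data satisfies `|RNE(t) - t| ≤ 1/17 · |t|`, and the constant is attained.
[folklore] -/
theorem E2M3_E2M1_add_E2M3_relNE_pattern :
    (∀ (a : MiniFloat E2M3) (b : MiniFloat E2M1),
        (1 : ℚ) ≤ |a.toRat + b.toRat| → |a.toRat + b.toRat| ≤ E2M3.maxRat →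
          |(roundNE E2M3 (a.toRat + b.toRat)).toRat - (a.toRat + b.toRat)|
            ≤ 1 / 17 * |a.toRat + b.toRat|) ∧
      ∃ (a : MiniFloat E2M3) (b : MiniFloat E2M1),
        (1 : ℚ) ≤ |a.toRat + b.toRat| ∧ |a.toRat + b.toRat| ≤ E2M3.maxRat ∧
          |(roundNE E2M3 (a.toRat + b.toRat)).toRat - (a.toRat + b.toRat)|
            = 1 / 17 * |a.toRat + b.toRat| :=
  add_relNE_normal_of_envconst E2M3 (by decide +kernel) E2M3_E2M1_add_E2M3_patternConstantNE
    (by decide +kernel)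

/-- `E2M3 + E2M3 → E2M3`, NEAREST pattern constant `1/17` (THEOREMS-R1 Theorem E5; no operand-pair
enumeration). [folklore] -/
theorem E2M3_E2M3_add_E2M3_patternConstantNE : envconstAddNE E2M3 E2M3 E2M3 = 1 / 17 := by
  decide +kernel

/-- `E2M3 + E2M3 → E2M3`, TOWARD-ZERO pattern constant `3/35`. [folklore] -/
theorem E2M3_E2M3_add_E2M3_patternConstantTZ : envconstAddTZ E2M3 E2M3 E2M3 = 3 / 35 := by
  decide +kernel

/-- `E2M3 + E2M3 → E2M3`, DIRECTED (round down = round up) pattern constant `1/11`. [folklore] -/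
theorem E2M3_E2M3_add_E2M3_patternConstantDir : envconstAddDir E2M3 E2M3 E2M3 = 1 / 11 := by
  decide +kernel

/-- `E2M3 + E2M3 → E2M3`, NEAREST, by the PATTERN ROUTE: on the normal range `1 ≤ |t| ≤ 15/2`
of `E2M3` every sum of data satisfies `|RNE(t) - t| ≤ 1/17 · |t|`, and the constant is attained.
[folklore] -/
theorem E2M3_E2M3_add_E2M3_relNE_pattern :
    (∀ (a : MiniFloat E2M3) (b : MiniFloat E2M3),
        (1 : ℚ) ≤ |a.toRat + b.toRat| → |a.toRat + b.toRat| ≤ E2M3.maxRat →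
          |(roundNE E2M3 (a.toRat + b.toRat)).toRat - (a.toRat + b.toRat)|
            ≤ 1 / 17 * |a.toRat + b.toRat|) ∧
      ∃ (a : MiniFloat E2M3) (b : MiniFloat E2M3),
        (1 : ℚ) ≤ |a.toRat + b.toRat| ∧ |a.toRat + b.toRat| ≤ E2M3.maxRat ∧
          |(roundNE E2M3 (a.toRat + b.toRat)).toRat - (a.toRat + b.toRat)|
            = 1 / 17 * |a.toRat + b.toRat| :=
  add_relNE_normal_of_envconst E2M3 (by decide +kernel) E2M3_E2M3_add_E2M3_patternConstantNE
    (by decide +kernel)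

/-- `E2M3 + E3M2 → E2M3`, NEAREST pattern constant `1/17` (THEOREMS-R1 Theorem E5; no operand-pair
enumeration). [folklore] -/
theorem E2M3_E3M2_add_E2M3_patternConstantNE : envconstAddNE E2M3 E3M2 E2M3 = 1 / 17 := by
  decide +kernel

/-- `E2M3 + E3M2 → E2M3`, TOWARD-ZERO pattern constant `7/71`. [folklore] -/
theorem E2M3_E3M2_add_E2M3_patternConstantTZ : envconstAddTZ E2M3 E3M2 E2M3 = 7 / 71 := by
  decide +kernel

/-- `E2M3 + E3M2 → E2M3`, DIRECTED (round down = round up) pattern constant `7/65`. [folklore] -/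
theorem E2M3_E3M2_add_E2M3_patternConstantDir : envconstAddDir E2M3 E3M2 E2M3 = 7 / 65 := by
  decide +kernel

/-- `E2M3 + E3M2 → E2M3`, NEAREST, by the PATTERN ROUTE: on the normal range `1 ≤ |t| ≤ 15/2`
of `E2M3` every sum of data satisfies `|RNE(t) - t| ≤ 1/17 · |t|`, and the constant is attained.
[folklore] -/
theorem E2M3_E3M2_add_E2M3_relNE_pattern :
    (∀ (a : MiniFloat E2M3) (b : MiniFloat E3M2),
        (1 : ℚ) ≤ |a.toRat + b.toRat| → |a.toRat + b.toRat| ≤ E2M3.maxRat →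
          |(roundNE E2M3 (a.toRat + b.toRat)).toRat - (a.toRat + b.toRat)|
            ≤ 1 / 17 * |a.toRat + b.toRat|) ∧
      ∃ (a : MiniFloat E2M3) (b : MiniFloat E3M2),
        (1 : ℚ) ≤ |a.toRat + b.toRat| ∧ |a.toRat + b.toRat| ≤ E2M3.maxRat ∧
          |(roundNE E2M3 (a.toRat + b.toRat)).toRat - (a.toRat + b.toRat)|
            = 1 / 17 * |a.toRat + b.toRat| :=
  add_relNE_normal_of_envconst E2M3 (by decide +kernel) E2M3_E3M2_add_E2M3_patternConstantNE
    (by decide +kernel)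

/-- `E3M2 + E2M1 → E3M2`, NEAREST pattern constant `1/9` (THEOREMS-R1 Theorem E5; no operand-pair
enumeration). [folklore] -/
theorem E3M2_E2M1_add_E3M2_patternConstantNE : envconstAddNE E3M2 E2M1 E3M2 = 1 / 9 := by
  decide +kernel

/-- `E3M2 + E2M1 → E3M2`, TOWARD-ZERO pattern constant `7/39`. [folklore] -/
theorem E3M2_E2M1_add_E3M2_patternConstantTZ : envconstAddTZ E3M2 E2M1 E3M2 = 7 / 39 := by
  decide +kernel

/-- `E3M2 + E2M1 → E3M2`, DIRECTED (round down = round up) pattern constant `3/13`. [folklore] -/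
theorem E3M2_E2M1_add_E3M2_patternConstantDir : envconstAddDir E3M2 E2M1 E3M2 = 3 / 13 := by
  decide +kernel

/-- `E3M2 + E2M1 → E3M2`, NEAREST, by the PATTERN ROUTE: on the normal range `1/4 ≤ |t| ≤ 28`
of `E3M2` every sum of data satisfies `|RNE(t) - t| ≤ 1/9 · |t|`, and the constant is attained.
[folklore] -/
theorem E3M2_E2M1_add_E3M2_relNE_pattern :
    (∀ (a : MiniFloat E3M2) (b : MiniFloat E2M1),
        (1 / 4 : ℚ) ≤ |a.toRat + b.toRat| → |a.toRat + b.toRat| ≤ E3M2.maxRat →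
          |(roundNE E3M2 (a.toRat + b.toRat)).toRat - (a.toRat + b.toRat)|
            ≤ 1 / 9 * |a.toRat + b.toRat|) ∧
      ∃ (a : MiniFloat E3M2) (b : MiniFloat E2M1),
        (1 / 4 : ℚ) ≤ |a.toRat + b.toRat| ∧ |a.toRat + b.toRat| ≤ E3M2.maxRat ∧
          |(roundNE E3M2 (a.toRat + b.toRat)).toRat - (a.toRat + b.toRat)|
            = 1 / 9 * |a.toRat + b.toRat| :=
  add_relNE_normal_of_envconst E3M2 (by decide +kernel) E3M2_E2M1_add_E3M2_patternConstantNE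
    (by decide +kernel)

/-- `E3M2 + E2M3 → E3M2`, NEAREST pattern constant `1/9` (THEOREMS-R1 Theorem E5; no operand-pair
enumeration). [folklore] -/
theorem E3M2_E2M3_add_E3M2_patternConstantNE : envconstAddNE E3M2 E2M3 E3M2 = 1 / 9 := by
  decide +kernel

/-- `E3M2 + E2M3 → E3M2`, TOWARD-ZERO pattern constant `31/159`. [folklore] -/
theorem E3M2_E2M3_add_E3M2_patternConstantTZ : envconstAddTZ E3M2 E2M3 E3M2 = 31 / 159 := by
  decide +kernel

/-- `E3M2 + E2M3 → E3M2`, DIRECTED (round down = round up) pattern constant `31/129`. [folklore] -/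
theorem E3M2_E2M3_add_E3M2_patternConstantDir : envconstAddDir E3M2 E2M3 E3M2 = 31 / 129 := by
  decide +kernel

/-- `E3M2 + E2M3 → E3M2`, NEAREST, by the PATTERN ROUTE: on the normal range `1/4 ≤ |t| ≤ 28`
of `E3M2` every sum of data satisfies `|RNE(t) - t| ≤ 1/9 · |t|`, and the constant is attained.
[folklore] -/
theorem E3M2_E2M3_add_E3M2_relNE_pattern :
    (∀ (a : MiniFloat E3M2) (b : MiniFloat E2M3),
        (1 / 4 : ℚ) ≤ |a.toRat + b.toRat| → |a.toRat + b.toRat| ≤ E3M2.maxRat →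
          |(roundNE E3M2 (a.toRat + b.toRat)).toRat - (a.toRat + b.toRat)|
            ≤ 1 / 9 * |a.toRat + b.toRat|) ∧
      ∃ (a : MiniFloat E3M2) (b : MiniFloat E2M3),
        (1 / 4 : ℚ) ≤ |a.toRat + b.toRat| ∧ |a.toRat + b.toRat| ≤ E3M2.maxRat ∧
          |(roundNE E3M2 (a.toRat + b.toRat)).toRat - (a.toRat + b.toRat)|
            = 1 / 9 * |a.toRat + b.toRat| :=
  add_relNE_normal_of_envconst E3M2 (by decide +kernel) E3M2_E2M3_add_E3M2_patternConstantNE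
    (by decide +kernel)

/-- `E3M2 + E3M2 → E3M2`, NEAREST pattern constant `1/9` (THEOREMS-R1 Theorem E5; no operand-pair
enumeration). [folklore] -/
theorem E3M2_E3M2_add_E3M2_patternConstantNE : envconstAddNE E3M2 E3M2 E3M2 = 1 / 9 := by
  decide +kernel

/-- `E3M2 + E3M2 → E3M2`, TOWARD-ZERO pattern constant `63/319`. [folklore] -/
theorem E3M2_E3M2_add_E3M2_patternConstantTZ : envconstAddTZ E3M2 E3M2 E3M2 = 63 / 319 := by
  decide +kernel

/-- `E3M2 + E3M2 → E3M2`, DIRECTED (round down = round up) pattern constant `63/257`. [folklore] -/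
theorem E3M2_E3M2_add_E3M2_patternConstantDir : envconstAddDir E3M2 E3M2 E3M2 = 63 / 257 := by
  decide +kernel

/-- `E3M2 + E3M2 → E3M2`, NEAREST, by the PATTERN ROUTE: on the normal range `1/4 ≤ |t| ≤ 28`
of `E3M2` every sum of data satisfies `|RNE(t) - t| ≤ 1/9 · |t|`, and the constant is attained.
[folklore] -/
theorem E3M2_E3M2_add_E3M2_relNE_pattern :
    (∀ (a : MiniFloat E3M2) (b : MiniFloat E3M2),
        (1 / 4 : ℚ) ≤ |a.toRat + b.toRat| → |a.toRat + b.toRat| ≤ E3M2.maxRat →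
          |(roundNE E3M2 (a.toRat + b.toRat)).toRat - (a.toRat + b.toRat)|
            ≤ 1 / 9 * |a.toRat + b.toRat|) ∧
      ∃ (a : MiniFloat E3M2) (b : MiniFloat E3M2),
        (1 / 4 : ℚ) ≤ |a.toRat + b.toRat| ∧ |a.toRat + b.toRat| ≤ E3M2.maxRat ∧
          |(roundNE E3M2 (a.toRat + b.toRat)).toRat - (a.toRat + b.toRat)|
            = 1 / 9 * |a.toRat + b.toRat| :=
  add_relNE_normal_of_envconst E3M2 (by decide +kernel) E3M2_E3M2_add_E3M2_patternConstantNE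
    (by decide +kernel)

end Summit.Ventures.CertifiedArithmetic
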